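import Mathlib.Analysis.InnerProductSpace.Calculus
import Mathlib.Analysis.Calculus.Deriv.Inv
import Mathlib.Analysis.Calculus.FDeriv.Prod
import Mathlib.Analysis.Calculus.ContDiff.Basic
import Mathlib.LinearAlgebra.FiniteDimensional.Basic
import Mathlib.Topology.Algebra.Module.FiniteDimension
import HarnessLib

/-!
# Radial family maps `y ↦ ρ‖y‖ Ψ_{λ(‖y‖)}(x, y)`: smoothness and nondegeneracy (untwist zones and core)

Topic `Literature/Topology/FourManifolds`; Euclidean analysis in `E × F` (`E` parameters along a
simplex, `F` the normal inner product space).  This is the radial device of the codimension `≥ 2`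
steps of the smoothing of PD homeomorphisms (Munkres, Ann. of Math. 72 (1960), §§4–5;
Campbell–D'Onofrio–Vítek, J. Geom. Anal. (2026), Lemma 3.2 Step 4 / Lemma 3.4 Step 3, where a
diffeomorphism `h` of the link sphere is "untwisted" through an isotopy `α`:
`g = λ x₃ + tρ α(θ, (5t - 2r)/r)` resp. `g x = ρ|x| Ψ(x, η((4|x| - 2R)/R))`), in the parametrised
form needed on a simplex: a **unit family** `Ψ : ℝ → E × F → F` (smooth in all variables on
`ℝ × V × (F ∖ 0)`, `‖Ψ_s p‖ = 1`, with nondegenerate angular derivative) and a smooth **pacing**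
`λ : ℝ → ℝ` give the fibre map

  `radialFamilyMap ρ Ψ λ p = (ρ ‖p.2‖) • Ψ (λ ‖p.2‖) p`

and the stage map `p ↦ (p.1, radialFamilyMap ρ Ψ λ p)`.  We prove: it is `C^∞` off the zero
section (`contDiffAt_radialFamilyMap`); its derivative is invertible there
(`exists_hasFDerivAt_equiv_radialStageMap`: if `DΦ (v, w) = 0` then `v = 0`, pairing with `Ψ`
kills everything but `ρ⟪ŷ, w⟫` since `Ψ` is a unit field, and the remaining angular equation is
the nondegeneracy hypothesis) — with NO condition on `λ'`; and when `Ψ_s = R ∘ (y ↦ y/‖y‖)` for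
`s ≤ 0` with `R` a linear isometry and `λ = 0` near `0`, the map is the linear map `ρ R` near the
zero section, hence `C^∞` everywhere (`contDiffAt_radialStageMap_core`, the **linear core**; cf.
the tree's `contDiff_radialExtensionFun`, `RadialExtension.lean`, which is the case without
parameters and with the identity at the core).  The pacing only matters for the SIZE of the Euler
defect `D_yφ·y - φ = ρ‖y‖² λ'(‖y‖) ∂_sΨ`, recorded in `radialFamilyMap_euler_defect`.
No named facts are introduced.

## References

* J. R. Munkres, *Obstructions to the smoothing of piecewise-differentiable homeomorphisms*, Ann.
  of Math. (2) 72 (1960), 521–554, §§4–5. [Munkres1960]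
* D. Campbell, L. D'Onofrio, T. Vítek, *Diffeomorphic approximation of piecewise affine
  homeomorphisms*, J. Geom. Anal. 36 (2026), Lemma 3.2 (Step 4), Lemma 3.4 (Step 3).
  [CampbellDonofrioVitek2026]
* J. Cerf, *Sur les difféomorphismes de la sphère de dimension trois (Γ₄ = 0)*, LNM 53 (1968),
  Ch. I §1, Lemme 2 (radial extension of an isotopy). [CerfDiffeoSphere1968]
-/

noncomputable section

open Set Function Metric Filter
open scoped Topology ContDiff RealInnerProductSpace

namespace Literature.Topology.FourManifolds

/-! ### §1 Calculus of the norm and of the radial projection (private copies) -/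

section NormCalculus

variable {F : Type*} [NormedAddCommGroup F] [InnerProductSpace ℝ F]

/-- `∞ ≠ 0` in the smoothness exponents (bookkeeping). [folklore] -/
private theorem radial_infty_ne_zero : (∞ : WithTop ℕ∞) ≠ 0 := by
  simp

/-- Derivative of the norm away from `0`: `D‖·‖(y) = ⟪y/‖y‖, ·⟫` (a private copy of the tree's
`Literature.Analysis.Potential.HyperbolicBall.hasFDerivAt_norm_of_ne_zero`, not imported here to
keep the import closure small). [folklore] -/
private theorem hasFDerivAt_norm_radial {y : F} (hy : y ≠ 0) :
    HasFDerivAt (fun z : F => ‖z‖) (innerSL ℝ (‖y‖⁻¹ • y)) y := by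
  have hy2 : ‖y‖ ^ 2 ≠ 0 := by positivity
  have h2 := (hasStrictFDerivAt_norm_sq y).hasFDerivAt.sqrt hy2
  have hfun : (fun z : F => ‖z‖) = fun z => Real.sqrt (‖z‖ ^ 2) := by
    funext z
    rw [Real.sqrt_sq (norm_nonneg z)]
  rw [hfun]
  refine h2.congr_fderiv (ContinuousLinearMap.ext fun v => ?_)
  rw [Real.sqrt_sq (norm_nonneg y)]
  have hy0 : ‖y‖ ≠ 0 := norm_ne_zero_iff.2 hy
  simp only [innerSL_apply_apply, real_inner_smul_left]
  change (1 / (2 * ‖y‖)) • ((2 : ℕ) • innerSL ℝ y) v = ‖y‖⁻¹ * ⟪y, v⟫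
  rw [two_nsmul]
  change (1 / (2 * ‖y‖)) * (⟪y, v⟫ + ⟪y, v⟫) = ‖y‖⁻¹ * ⟪y, v⟫
  field_simp
  ring

/-- The norm composed with the second projection is differentiable off the zero section, with
derivative `(v, w) ↦ ⟪ŷ, w⟫`. [folklore] -/
theorem hasFDerivAt_norm_snd {E : Type*} [NormedAddCommGroup E] [NormedSpace ℝ E] {p : E × F}
    (hp : p.2 ≠ 0) :
    HasFDerivAt (fun q : E × F => ‖q.2‖)
      ((innerSL ℝ (‖p.2‖⁻¹ • p.2)).comp (ContinuousLinearMap.snd ℝ E F)) p :=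
  (hasFDerivAt_norm_radial hp).comp p hasFDerivAt_snd

end NormCalculus

/-! ### §2 Unit families and their first-order identities -/

section UnitFamily

variable {E : Type*} [NormedAddCommGroup E] [NormedSpace ℝ E]
variable {F : Type*} [NormedAddCommGroup F] [InnerProductSpace ℝ F]

/-- The domain `V × (F ∖ 0)` of a radial family (off the zero section). [folklore] -/
def radialDomain (V : Set E) : Set (E × F) := V ×ˢ {y | y ≠ 0}

variable {V : Set E}

omit [NormedSpace ℝ E] [InnerProductSpace ℝ F] in
/-- The radial domain of an open parameter set is open. [folklore] -/
theorem isOpen_radialDomain (hV : IsOpen V) : IsOpen (radialDomain (F := F) V) :=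
  hV.prod isOpen_ne

omit [NormedAddCommGroup E] [NormedSpace ℝ E] [InnerProductSpace ℝ F] in
/-- Membership in the radial domain. [folklore] -/
theorem mem_radialDomain {p : E × F} : p ∈ radialDomain V ↔ p.1 ∈ V ∧ p.2 ≠ 0 := Iff.rfl

/-- **A unit family has derivatives orthogonal to itself**: if `Ψ : ℝ → E × F → F` is
differentiable at `(s, p)` as a function of all variables and `‖Ψ‖ = 1` near `(s, p)`, then
`⟪Ψ s p, D(uncurry Ψ)(s, p) ξ⟫ = 0` for every direction `ξ` (differentiate `‖Ψ‖² = 1`).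
[folklore] -/
theorem inner_fderiv_unitFamily_eq_zero {Ψ : ℝ → E × F → F} {s : ℝ} {p : E × F}
    (hd : DifferentiableAt ℝ (uncurry Ψ) (s, p))
    (hunit : ∀ᶠ q in 𝓝 (s, p), ‖uncurry Ψ q‖ = 1) (ξ : ℝ × (E × F)) :
    ⟪Ψ s p, fderiv ℝ (uncurry Ψ) (s, p) ξ⟫ = 0 := by
  have h1 : HasFDerivAt (fun q => ‖uncurry Ψ q‖ ^ 2)
      (2 • (innerSL ℝ (uncurry Ψ (s, p))).comp (fderiv ℝ (uncurry Ψ) (s, p))) (s, p) :=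
    hd.hasFDerivAt.norm_sq
  have h2 : HasFDerivAt (fun q : ℝ × (E × F) => ‖uncurry Ψ q‖ ^ 2) (0 : ℝ × (E × F) →L[ℝ] ℝ)
      (s, p) := by
    refine (hasFDerivAt_const (1 : ℝ) (s, p)).congr_of_eventuallyEq ?_
    filter_upwards [hunit] with q hq
    rw [hq, one_pow]
  have h := congrArg (fun L : ℝ × (E × F) →L[ℝ] ℝ => L ξ) (h1.unique h2)
  change ((2 : ℕ) • (innerSL ℝ (uncurry Ψ (s, p))).comp (fderiv ℝ (uncurry Ψ) (s, p))) ξ =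
    (0 : ℝ × (E × F) →L[ℝ] ℝ) ξ at h
  rw [two_nsmul] at h
  change ⟪uncurry Ψ (s, p), fderiv ℝ (uncurry Ψ) (s, p) ξ⟫ +
    ⟪uncurry Ψ (s, p), fderiv ℝ (uncurry Ψ) (s, p) ξ⟫ = 0 at h
  have : ⟪uncurry Ψ (s, p), fderiv ℝ (uncurry Ψ) (s, p) ξ⟫ = 0 := by linarith
  exact this

/-- **A family homogeneous of degree zero in the fibre has no radial derivative**: if
`Ψ s (x, c • y) = Ψ s (x, y)` for `c` near `1` and `uncurry Ψ` is differentiable at `(s, (x, y))`,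
then `D(uncurry Ψ)(s, (x, y)) (0, (0, y)) = 0` (differentiate along `c ↦ (s, (x, c • y))` at
`c = 1`). [folklore] -/
theorem fderiv_unitFamily_radial_eq_zero {Ψ : ℝ → E × F → F} {s : ℝ} {p : E × F}
    (hd : DifferentiableAt ℝ (uncurry Ψ) (s, p))
    (hhom : ∀ᶠ c in 𝓝 (1 : ℝ), Ψ s (p.1, c • p.2) = Ψ s p) :
    fderiv ℝ (uncurry Ψ) (s, p) (0, ((0 : E), p.2)) = 0 := by
  -- the curve `c ↦ (s, (x, c • y))` through `(s, p)` at `c = 1`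
  have hcurve : HasDerivAt (fun c : ℝ => ((s, (p.1, c • p.2)) : ℝ × (E × F)))
      ((0, ((0 : E), p.2)) : ℝ × (E × F)) 1 := by
    have h1 : HasDerivAt (fun c : ℝ => c • p.2) p.2 1 := by
      simpa using (hasDerivAt_id (1 : ℝ)).smul_const p.2
    exact (hasDerivAt_const (1 : ℝ) s).prodMk ((hasDerivAt_const (1 : ℝ) p.1).prodMk h1)
  have hcomp : HasDerivAt (fun c : ℝ => uncurry Ψ (s, (p.1, c • p.2)))
      (fderiv ℝ (uncurry Ψ) (s, p) (0, ((0 : E), p.2))) 1 :=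
    hd.hasFDerivAt.comp_hasDerivAt_of_eq 1 hcurve (by simp)
  have hconst : HasDerivAt (fun c : ℝ => uncurry Ψ (s, (p.1, c • p.2))) 0 1 := by
    refine (hasDerivAt_const (1 : ℝ) (Ψ s p)).congr_of_eventuallyEq ?_
    filter_upwards [hhom] with c hc
    exact hc
  exact hcomp.unique hconst

end UnitFamily

/-! ### §3 The radial family map and its stage map -/

section RadialFamily

variable {E : Type*} [NormedAddCommGroup E] [NormedSpace ℝ E]
variable {F : Type*} [NormedAddCommGroup F] [InnerProductSpace ℝ F]

/-- **The radial family map** `φ p = (ρ ‖p.2‖) • Ψ (λ ‖p.2‖) p` of a family `Ψ : ℝ → E × F → F`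
with pacing `λ : ℝ → ℝ` and radius scale `ρ`: on the sphere bundle of radius `t` it is `ρ t`
times the stage `Ψ_{λ t}`.  (At `p.2 = 0` the value is `0`, whatever junk `Ψ` has there.)
Campbell–D'Onofrio–Vítek (2026), Lemma 3.2 Step 4 (`t ρ α(θ, (5t-2r)/r)`), Lemma 3.4 Step 3
(`ρ|x| Ψ(x, η)`); Cerf (1968), Ch. I §1, Lemme 2. [cite: CampbellDonofrioVitek2026, Lemma 3.2 (Step 4)] -/
def radialFamilyMap (ρ : ℝ) (Ψ : ℝ → E × F → F) (lam : ℝ → ℝ) (p : E × F) : F :=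
  (ρ * ‖p.2‖) • Ψ (lam ‖p.2‖) p

/-- **The radial stage map** `Φ p = (p.1, φ p)`: the parameters are kept, the fibre is replaced by
the radial family map. [folklore] -/
def radialStageMap (ρ : ℝ) (Ψ : ℝ → E × F → F) (lam : ℝ → ℝ) (p : E × F) : E × F :=
  (p.1, radialFamilyMap ρ Ψ lam p)

variable {ρ : ℝ} {Ψ : ℝ → E × F → F} {lam : ℝ → ℝ} {V : Set E} {p : E × F}

omit [NormedAddCommGroup E] [NormedSpace ℝ E] in
/-- The stage map keeps the parameters. [folklore] -/
@[simp]
theorem radialStageMap_fst (p : E × F) : (radialStageMap ρ Ψ lam p).1 = p.1 := rfl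

omit [NormedAddCommGroup E] [NormedSpace ℝ E] in
/-- The fibre component of the stage map is the radial family map. [folklore] -/
@[simp]
theorem radialStageMap_snd (p : E × F) : (radialStageMap ρ Ψ lam p).2 = radialFamilyMap ρ Ψ lam p :=
  rfl

omit [NormedAddCommGroup E] [NormedSpace ℝ E] in
/-- On the zero section the radial family map vanishes. [folklore] -/
theorem radialFamilyMap_zero (x : E) : radialFamilyMap ρ Ψ lam (x, 0) = 0 := by
  simp [radialFamilyMap]

omit [NormedAddCommGroup E] [NormedSpace ℝ E] in
/-- **The norm of the radial family map is `ρ ‖y‖`** for a unit family (`ρ ≥ 0`). [folklore] -/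
theorem norm_radialFamilyMap (hρ : 0 ≤ ρ) (hunit : ‖Ψ (lam ‖p.2‖) p‖ = 1) :
    ‖radialFamilyMap ρ Ψ lam p‖ = ρ * ‖p.2‖ := by
  rw [radialFamilyMap, norm_smul, hunit, mul_one, Real.norm_of_nonneg (mul_nonneg hρ (norm_nonneg _))]

/-- **Smoothness off the zero section.** If `uncurry Ψ` is `C^∞` at `(λ ‖p.2‖, p)` and `λ` is
`C^∞` at `‖p.2‖`, `p.2 ≠ 0`, then the radial family map is `C^∞` at `p`. [folklore] -/
theorem contDiffAt_radialFamilyMap (hp : p.2 ≠ 0)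
    (hΨ : ContDiffAt ℝ ∞ (uncurry Ψ) (lam ‖p.2‖, p)) (hlam : ContDiffAt ℝ ∞ lam ‖p.2‖) :
    ContDiffAt ℝ ∞ (radialFamilyMap ρ Ψ lam) p := by
  have hn : ContDiffAt ℝ ∞ (fun q : E × F => ‖q.2‖) p := (contDiffAt_norm ℝ hp).comp p contDiffAt_snd
  have h1 : ContDiffAt ℝ ∞ (fun q : E × F => (lam ‖q.2‖, q)) p := (hlam.comp p hn).prodMk contDiffAt_id
  have h2 : ContDiffAt ℝ ∞ (fun q : E × F => Ψ (lam ‖q.2‖) q) p :=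
    ContDiffAt.comp (g := uncurry Ψ) (f := fun q : E × F => (lam ‖q.2‖, q)) p hΨ h1
  exact (contDiffAt_const.mul hn).smul h2

/-- Smoothness of the stage map off the zero section. [folklore] -/
theorem contDiffAt_radialStageMap (hp : p.2 ≠ 0)
    (hΨ : ContDiffAt ℝ ∞ (uncurry Ψ) (lam ‖p.2‖, p)) (hlam : ContDiffAt ℝ ∞ lam ‖p.2‖) :
    ContDiffAt ℝ ∞ (radialStageMap ρ Ψ lam) p :=
  contDiffAt_fst.prodMk (contDiffAt_radialFamilyMap hp hΨ hlam)

/-- **The derivative of the radial family map** off the zero section. Write `t = ‖p.2‖`,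
`ŷ = p.2 / t`, `L = D(uncurry Ψ)(λ t, p)`. Then
`Dφ p (v, w) = (ρ t) • L (λ'(t) ⟪ŷ, w⟫, (v, w)) + (ρ ⟪ŷ, w⟫) • Ψ`.
[folklore] -/
theorem hasFDerivAt_radialFamilyMap (hp : p.2 ≠ 0)
    (hΨ : DifferentiableAt ℝ (uncurry Ψ) (lam ‖p.2‖, p)) {lam' : ℝ} (hlam : HasDerivAt lam lam' ‖p.2‖) :
    HasFDerivAt (radialFamilyMap ρ Ψ lam)
      ((ρ * ‖p.2‖) • (fderiv ℝ (uncurry Ψ) (lam ‖p.2‖, p)).comp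
          ((lam' • (innerSL ℝ (‖p.2‖⁻¹ • p.2)).comp (ContinuousLinearMap.snd ℝ E F)).prod
            (ContinuousLinearMap.id ℝ (E × F))) +
        ((ρ : ℝ) • (innerSL ℝ (‖p.2‖⁻¹ • p.2)).comp (ContinuousLinearMap.snd ℝ E F)).smulRight
          (Ψ (lam ‖p.2‖) p)) p := by
  -- the inner map `q ↦ (λ ‖q.2‖, q)` and its derivative
  have hn : HasFDerivAt (fun q : E × F => ‖q.2‖)
      ((innerSL ℝ (‖p.2‖⁻¹ • p.2)).comp (ContinuousLinearMap.snd ℝ E F)) p :=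
    hasFDerivAt_norm_snd hp
  have hl : HasFDerivAt (fun q : E × F => lam ‖q.2‖)
      (lam' • (innerSL ℝ (‖p.2‖⁻¹ • p.2)).comp (ContinuousLinearMap.snd ℝ E F)) p :=
    hlam.comp_hasFDerivAt p hn
  have hin : HasFDerivAt (fun q : E × F => (lam ‖q.2‖, q))
      ((lam' • (innerSL ℝ (‖p.2‖⁻¹ • p.2)).comp (ContinuousLinearMap.snd ℝ E F)).prod
        (ContinuousLinearMap.id ℝ (E × F))) p :=
    hl.prodMk (hasFDerivAt_id p)
  have hΨ' : HasFDerivAt (fun q : E × F => Ψ (lam ‖q.2‖) q)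
      ((fderiv ℝ (uncurry Ψ) (lam ‖p.2‖, p)).comp
        ((lam' • (innerSL ℝ (‖p.2‖⁻¹ • p.2)).comp (ContinuousLinearMap.snd ℝ E F)).prod
          (ContinuousLinearMap.id ℝ (E × F)))) p :=
    HasFDerivAt.comp (g := uncurry Ψ) (f := fun q : E × F => (lam ‖q.2‖, q)) p hΨ.hasFDerivAt hin
  have hc : HasFDerivAt (fun q : E × F => ρ * ‖q.2‖)
      ((ρ : ℝ) • (innerSL ℝ (‖p.2‖⁻¹ • p.2)).comp (ContinuousLinearMap.snd ℝ E F)) p :=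
    hn.const_mul ρ
  exact hc.smul hΨ'

/-- **Nondegeneracy of the radial stage map.** Let `p = (x, y)` with `y ≠ 0`, `ρ ≠ 0`; let
`uncurry Ψ` be differentiable at `(λ ‖y‖, p)` with `‖Ψ‖ = 1` nearby, `λ` differentiable at `‖y‖`,
and assume the **angular derivative of the stage is nondegenerate**: for `w ⊥ y`,
`D(uncurry Ψ)(λ ‖y‖, p) (0, (0, w)) = 0 ⟹ w = 0`.  Then the derivative of the stage map
`Φ p = (p.1, φ p)` at `p` is injective, hence a linear isomorphism of the finite-dimensional space
`E × F`: if `DΦ (v, w) = 0` then `v = 0`; pairing `Dφ (0, w) = 0` with the unit vector `Ψ` kills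
the derivative terms (`⟪Ψ, L ξ⟫ = 0`) and leaves `ρ ⟪ŷ, w⟫ = 0`, so `w ⊥ y`, and then
`Dφ (0, w) = (ρ t) L (0, (0, w)) = 0` forces `w = 0`.  No condition on `λ'` is needed.
[folklore] -/
theorem injective_fderiv_radialStageMap (hp : p.2 ≠ 0) (hρ : ρ ≠ 0)
    (hΨ : DifferentiableAt ℝ (uncurry Ψ) (lam ‖p.2‖, p))
    (hunit : ∀ᶠ q in 𝓝 (lam ‖p.2‖, p), ‖uncurry Ψ q‖ = 1)
    (hlam : DifferentiableAt ℝ lam ‖p.2‖)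
    (hker : ∀ w : F, ⟪p.2, w⟫ = 0 →
      fderiv ℝ (uncurry Ψ) (lam ‖p.2‖, p) (0, ((0 : E), w)) = 0 → w = 0) :
    Injective (fderiv ℝ (radialStageMap ρ Ψ lam) p) := by
  set t : ℝ := ‖p.2‖ with ht
  have ht0 : 0 < t := norm_pos_iff.2 hp
  set L := fderiv ℝ (uncurry Ψ) (lam ‖p.2‖, p) with hL
  have hφ := hasFDerivAt_radialFamilyMap (ρ := ρ) hp hΨ hlam.hasDerivAt
  have hΦ : HasFDerivAt (radialStageMap ρ Ψ lam)
      ((ContinuousLinearMap.fst ℝ E F).prod _) p := hasFDerivAt_fst.prodMk hφ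
  rw [hΦ.fderiv]
  refine (injective_iff_map_eq_zero _).2 fun vw h => ?_
  obtain ⟨v, w⟩ := vw
  have h1 := congrArg Prod.fst h
  have h2 := congrArg Prod.snd h
  simp only [ContinuousLinearMap.prod_apply, ContinuousLinearMap.coe_fst', Prod.fst_zero] at h1
  subst h1
  simp only [ContinuousLinearMap.prod_apply, Prod.snd_zero] at h2
  -- `h2 : Dφ (0, w) = 0`; unfold the formula
  change (ρ * ‖p.2‖) • L (deriv lam ‖p.2‖ • ⟪‖p.2‖⁻¹ • p.2, ((0 : E), w).2⟫, ((0 : E), w)) +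
      (ρ • ⟪‖p.2‖⁻¹ • p.2, ((0 : E), w).2⟫) • Ψ (lam ‖p.2‖) p = 0 at h2
  simp only at h2
  -- `h2 : (ρ t) • L (λ' • ⟪ŷ, w⟫, (0, w)) + (ρ • ⟪ŷ, w⟫) • Ψ = 0`; pair with the unit vector `Ψ`
  have hperp : ∀ ξ, ⟪Ψ (lam ‖p.2‖) p, L ξ⟫ = 0 := fun ξ => inner_fderiv_unitFamily_eq_zero hΨ hunit ξ
  have hunit0 : ‖Ψ (lam ‖p.2‖) p‖ = 1 := hunit.self_of_nhds
  have hinner := congrArg (fun z => ⟪Ψ (lam ‖p.2‖) p, z⟫) h2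
  simp only [inner_add_right, inner_smul_right, real_inner_self_eq_norm_sq, hunit0, one_pow,
    mul_one, inner_zero_right] at hinner
  rw [hL] at hperp
  rw [hperp, mul_zero, zero_add] at hinner
  -- so `ρ ⟪ŷ, w⟫ = 0`, i.e. `w ⊥ y`
  have hyw : ⟪p.2, w⟫ = 0 := by
    have h3 : ρ • ⟪‖p.2‖⁻¹ • p.2, w⟫ = 0 := hinner
    rw [smul_eq_mul, real_inner_smul_left, ← mul_assoc] at h3
    have hρn : ρ * ‖p.2‖⁻¹ ≠ 0 := mul_ne_zero hρ (inv_ne_zero ht0.ne')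
    exact (mul_eq_zero.1 h3).resolve_left hρn
  -- then the angular equation
  have hyw' : ⟪‖p.2‖⁻¹ • p.2, w⟫ = 0 := by rw [real_inner_smul_left, hyw, mul_zero]
  simp only [hyw', smul_zero, zero_smul, add_zero] at h2
  have hρt : ρ * ‖p.2‖ ≠ 0 := mul_ne_zero hρ ht0.ne'
  have h5 : L (0, ((0 : E), w)) = 0 := by
    have h4 : (ρ * ‖p.2‖) • L (0, ((0 : E), w)) = 0 := by
      have := h2
      simpa using this
    exact (smul_eq_zero.1 h4).resolve_left hρt
  have hw : w = 0 := hker w hyw h5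
  rw [hw]
  rfl

/-- **The derivative of the radial stage map is a linear isomorphism** (finite-dimensional
`E`, `F`): packaged form of `injective_fderiv_radialStageMap` for the inverse function theorem.
[folklore] -/
theorem exists_hasFDerivAt_equiv_radialStageMap [FiniteDimensional ℝ E] [FiniteDimensional ℝ F]
    (hp : p.2 ≠ 0) (hρ : ρ ≠ 0)
    (hΨ : ContDiffAt ℝ ∞ (uncurry Ψ) (lam ‖p.2‖, p))
    (hunit : ∀ᶠ q in 𝓝 (lam ‖p.2‖, p), ‖uncurry Ψ q‖ = 1)
    (hlam : ContDiffAt ℝ ∞ lam ‖p.2‖)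
    (hker : ∀ w : F, ⟪p.2, w⟫ = 0 →
      fderiv ℝ (uncurry Ψ) (lam ‖p.2‖, p) (0, ((0 : E), w)) = 0 → w = 0) :
    ∃ L : (E × F) ≃L[ℝ] E × F,
      HasFDerivAt (radialStageMap ρ Ψ lam) (L : E × F →L[ℝ] E × F) p := by
  have hd : DifferentiableAt ℝ (radialStageMap ρ Ψ lam) p :=
    (contDiffAt_radialStageMap hp hΨ hlam).differentiableAt radial_infty_ne_zero
  have hinj := injective_fderiv_radialStageMap hp hρ (hΨ.differentiableAt radial_infty_ne_zero) hunit
    (hlam.differentiableAt radial_infty_ne_zero) hker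
  let L : (E × F) ≃L[ℝ] E × F :=
    LinearEquiv.toContinuousLinearEquiv
      (LinearEquiv.ofInjectiveEndo (fderiv ℝ (radialStageMap ρ Ψ lam) p).toLinearMap hinj)
  refine ⟨L, ?_⟩
  have hcoe : (L : E × F →L[ℝ] E × F) = fderiv ℝ (radialStageMap ρ Ψ lam) p :=
    ContinuousLinearMap.ext fun v => rfl
  rw [hcoe]
  exact hd.hasFDerivAt

/-- **Euler defect of the radial family map.** For a unit family homogeneous of degree zero in
the fibre, the deviation of `φ` from Euler's identity is
`Dφ p (0, y) - φ p = (ρ ‖y‖² λ'(‖y‖)) • ∂_sΨ`, `∂_sΨ = D(uncurry Ψ)(λ ‖y‖, p) (1, 0)`: it is the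
pacing speed `‖y‖ λ'(‖y‖)` (dimensionless) times `ρ‖y‖ ∂_sΨ`, so a slow pacing makes the map
conelike to first order.  (Campbell–D'Onofrio–Vítek (2026), proof of Lemma 3.2, estimate of
`∂_t g` on `P₃`.) [cite: CampbellDonofrioVitek2026, Lemma 3.2 (Step 4)] -/
theorem radialFamilyMap_euler_defect (hp : p.2 ≠ 0)
    (hΨ : DifferentiableAt ℝ (uncurry Ψ) (lam ‖p.2‖, p)) {lam' : ℝ}
    (hlam : HasDerivAt lam lam' ‖p.2‖)
    (hhom : ∀ᶠ c in 𝓝 (1 : ℝ), Ψ (lam ‖p.2‖) (p.1, c • p.2) = Ψ (lam ‖p.2‖) p) :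
    fderiv ℝ (radialFamilyMap ρ Ψ lam) p (0, p.2) - radialFamilyMap ρ Ψ lam p =
      (ρ * ‖p.2‖ ^ 2 * lam') • fderiv ℝ (uncurry Ψ) (lam ‖p.2‖, p) (1, 0) := by
  set L := fderiv ℝ (uncurry Ψ) (lam ‖p.2‖, p) with hL
  rw [(hasFDerivAt_radialFamilyMap (ρ := ρ) hp hΨ hlam).fderiv]
  have hyy : ⟪‖p.2‖⁻¹ • p.2, p.2⟫ = ‖p.2‖ := by
    rw [real_inner_smul_left, real_inner_self_eq_norm_sq, pow_two, ← mul_assoc,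
      inv_mul_cancel₀ (norm_ne_zero_iff.2 hp), one_mul]
  change (ρ * ‖p.2‖) • L (lam' • ⟪‖p.2‖⁻¹ • p.2, ((0 : E), p.2).2⟫, ((0 : E), p.2)) +
      (ρ • ⟪‖p.2‖⁻¹ • p.2, ((0 : E), p.2).2⟫) • Ψ (lam ‖p.2‖) p - radialFamilyMap ρ Ψ lam p =
    (ρ * ‖p.2‖ ^ 2 * lam') • L (1, 0)
  simp only [hyy]
  -- split `L (λ' t, (0, y)) = (λ' t) • L (1, 0) + L (0, (0, y))`, the second term vanishing
  have hsplit : L (lam' • ‖p.2‖, ((0 : E), p.2)) = (lam' * ‖p.2‖) • L (1, 0) + L (0, ((0 : E), p.2)) := by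
    have : ((lam' • ‖p.2‖, ((0 : E), p.2)) : ℝ × (E × F)) =
        (lam' * ‖p.2‖) • ((1 : ℝ), ((0 : E), (0 : F))) + (0, ((0 : E), p.2)) := by
      ext <;> simp
    rw [this, map_add, map_smul]
    rfl
  have hrad : L (0, ((0 : E), p.2)) = 0 := by
    rw [hL]
    exact fderiv_unitFamily_radial_eq_zero hΨ hhom
  rw [hsplit, hrad, add_zero, radialFamilyMap, smul_smul]
  have e1 : ρ * ‖p.2‖ * (lam' * ‖p.2‖) = ρ * ‖p.2‖ ^ 2 * lam' := by ring
  rw [e1, smul_eq_mul, add_sub_assoc, sub_self, add_zero]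

/-! ### §4 The linear core -/

omit [NormedAddCommGroup E] [NormedSpace ℝ E] in
/-- **Near the zero section the radial family map is linear.** If the pacing vanishes on
`(-∞, t₀]` and the stage `Ψ 0` is `R ∘ (y ↦ y/‖y‖)` (as a function of `p`, on `V × (F ∖ 0)`) for a
linear isometry `R`, then `φ p = ρ • R p.2` whenever `p.1 ∈ V`, `‖p.2‖ ≤ t₀` (also at `p.2 = 0`).
[folklore] -/
theorem radialFamilyMap_eq_core {R : F →ₗᵢ[ℝ] F} {t₀ : ℝ}
    (hlam0 : ∀ t ≤ t₀, lam t = 0)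
    (hΨ0 : ∀ q : E × F, q ∈ radialDomain V → Ψ 0 q = R (‖q.2‖⁻¹ • q.2))
    (hp1 : p.1 ∈ V) (hpt : ‖p.2‖ ≤ t₀) : radialFamilyMap ρ Ψ lam p = ρ • R p.2 := by
  by_cases hp : p.2 = 0
  · rw [radialFamilyMap, hp, norm_zero, mul_zero, zero_smul, map_zero, smul_zero]
  · rw [radialFamilyMap, hlam0 _ hpt, hΨ0 p ⟨hp1, hp⟩, LinearIsometry.map_smul, smul_smul,
      mul_assoc, mul_inv_cancel₀ (norm_ne_zero_iff.2 hp), mul_one]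

/-- **The linear core is smooth across the zero section.** Under the hypotheses of
`radialFamilyMap_eq_core` with `V` open and `t₀ > 0`, the radial family map is `C^∞` at every
point `(x, y)` with `x ∈ V`, `‖y‖ < t₀` — in particular on the zero section, where the formula
`(ρ ‖y‖) • Ψ …` is a priori singular. (Cf. the tree's `contDiff_radialExtensionFun`.)
[folklore] -/
theorem contDiffAt_radialFamilyMap_core {R : F →ₗᵢ[ℝ] F} {t₀ : ℝ} (hV : IsOpen V)
    (hlam0 : ∀ t ≤ t₀, lam t = 0)
    (hΨ0 : ∀ q : E × F, q ∈ radialDomain V → Ψ 0 q = R (‖q.2‖⁻¹ • q.2))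
    (hp1 : p.1 ∈ V) (hpt : ‖p.2‖ < t₀) : ContDiffAt ℝ ∞ (radialFamilyMap ρ Ψ lam) p := by
  have hev : radialFamilyMap ρ Ψ lam =ᶠ[𝓝 p] fun q : E × F => ρ • R q.2 := by
    have ho : IsOpen {q : E × F | q.1 ∈ V ∧ ‖q.2‖ < t₀} :=
      (hV.preimage continuous_fst).inter (isOpen_lt (continuous_norm.comp continuous_snd)
        continuous_const)
    filter_upwards [ho.mem_nhds ⟨hp1, hpt⟩] with q hq
    exact radialFamilyMap_eq_core hlam0 hΨ0 hq.1 hq.2.le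
  refine ContDiffAt.congr_of_eventuallyEq ?_ hev
  exact contDiffAt_const.smul (R.toContinuousLinearMap.contDiff.contDiffAt.comp p contDiffAt_snd)

/-- The stage map is `C^∞` near the zero section (linear core). [folklore] -/
theorem contDiffAt_radialStageMap_core {R : F →ₗᵢ[ℝ] F} {t₀ : ℝ} (hV : IsOpen V)
    (hlam0 : ∀ t ≤ t₀, lam t = 0)
    (hΨ0 : ∀ q : E × F, q ∈ radialDomain V → Ψ 0 q = R (‖q.2‖⁻¹ • q.2))
    (hp1 : p.1 ∈ V) (hpt : ‖p.2‖ < t₀) : ContDiffAt ℝ ∞ (radialStageMap ρ Ψ lam) p :=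
  contDiffAt_fst.prodMk (contDiffAt_radialFamilyMap_core hV hlam0 hΨ0 hp1 hpt)

/-- **The derivative of the stage map on the core is `(v, w) ↦ (v, ρ R w)`, a linear
isomorphism** (`ρ ≠ 0`). [folklore] -/
theorem exists_hasFDerivAt_equiv_radialStageMap_core {R : F →ₗᵢ[ℝ] F} {t₀ : ℝ} (hV : IsOpen V)
    (hρ : ρ ≠ 0) (hR : Surjective R) (hlam0 : ∀ t ≤ t₀, lam t = 0)
    (hΨ0 : ∀ q : E × F, q ∈ radialDomain V → Ψ 0 q = R (‖q.2‖⁻¹ • q.2))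
    (hp1 : p.1 ∈ V) (hpt : ‖p.2‖ < t₀) :
    ∃ L : (E × F) ≃L[ℝ] E × F,
      HasFDerivAt (radialStageMap ρ Ψ lam) (L : E × F →L[ℝ] E × F) p := by
  -- the linear isometry equivalence `R` and the isomorphism `(v, w) ↦ (v, ρ R w)`
  let Re : F ≃ₗᵢ[ℝ] F := LinearIsometryEquiv.ofSurjective R hR
  let S : F ≃L[ℝ] F := (Re.toContinuousLinearEquiv : F ≃L[ℝ] F).trans
    (ContinuousLinearEquiv.smulLeft (Units.mk0 ρ hρ))
  have hS : ∀ w, S w = ρ • R w := fun w => rfl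
  refine ⟨(ContinuousLinearEquiv.refl ℝ E).prodCongr S, ?_⟩
  have hev : radialStageMap ρ Ψ lam =ᶠ[𝓝 p] fun q : E × F => (q.1, ρ • R q.2) := by
    have ho : IsOpen {q : E × F | q.1 ∈ V ∧ ‖q.2‖ < t₀} :=
      (hV.preimage continuous_fst).inter (isOpen_lt (continuous_norm.comp continuous_snd)
        continuous_const)
    filter_upwards [ho.mem_nhds ⟨hp1, hpt⟩] with q hq
    exact Prod.ext rfl (radialFamilyMap_eq_core hlam0 hΨ0 hq.1 hq.2.le)
  refine HasFDerivAt.congr_of_eventuallyEq ?_ hev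
  have h2 : HasFDerivAt (fun q : E × F => ρ • R q.2)
      ((S : F →L[ℝ] F).comp (ContinuousLinearMap.snd ℝ E F)) p := by
    have := ((ρ • R.toContinuousLinearMap).hasFDerivAt (x := p.2)).comp p hasFDerivAt_snd
    refine this.congr_fderiv (ContinuousLinearMap.ext fun q => ?_)
    exact (hS q.2).symm
  have := hasFDerivAt_fst.prodMk h2
  refine this.congr_fderiv (ContinuousLinearMap.ext fun q => ?_)
  rfl

end RadialFamily

end Literature.Topology.FourManifolds
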